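import Literature.Computability.AlgebraicComplexity.CommutativeExtensionSimulation
import Literature.Computability.AlgebraicComplexity.DetInVP
import Literature.Computability.AlgebraicComplexity.CommTwistDim
import Summits.ValiantsHypothesis.ValiantsHypothesis.Theses.FermionizationDimension

/-!
# ValiantsHypothesis / FermionizationDimension — `SimulationCost`

Route `FermionizationDimension`, item `stmt-ValiantsHypothesis-7292` (support, rank 9): there is
an absolute `c` (here `c = 17`) such that a commutative realisation `(R, u, ℓ)` of the sign
character of `S_n` — `R` a commutative finite-dimensional `ℂ`-algebra with `dim_ℂ R ≤ s`,
`u ∈ R^{n×n}`, `ℓ : R → ℂ` linear with `ℓ(∏ᵢ u_{σ(i),i}) = sgn σ` — yields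
`L(per_n) ≤ (n + s + 2)^c` for the tree's fan-in-two circuit complexity `complexity` over `ℂ`.

Proof (Hrubeš–Yehudayoff 2011, Thm 4.2, composed with Berkowitz 1984):

* `per_n = ℓ(det_{R[X]}(X_{ij} u_{ij}))` coefficientwise — the twisted determinant formula
  `Literature.Computability.AlgebraicComplexity.linearMap_coeff_det_twist` with `sgn² = 1`
  (`lmap_det_twist_eq_perPoly`);
* `L_R(det (X_{ij} u_{ij})) ≤ 8(n+1)⁷ + n²` — the division-free determinant over every
  commutative ring (`complexity_detPoly_le`, Berkowitz) and one product gate per entry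
  (`complexity_det_twist_le`);
* simulation of the `d`-dimensional commutative coefficient algebra `R` (`d = finrank ℂ R ≤ s`,
  basis `Module.finBasis`) at cost `(5d³ + 6d² + 2d)` per gate plus `3d` for reading off `ℓ`
  (`Literature.Computability.AlgebraicComplexity.CommExtSim.complexity_lmap_le`);
* arithmetic: `(5d³ + 6d² + 2d)(8(n+1)⁷ + n²) + 3d ≤ 120 (n+s+2)^{10} ≤ (n+s+2)^{17}`
  (`simulationCost_arith`).

Nothing else is here.
-/

noncomputable section

namespace Summit.ValiantsHypothesis.Theorems

open MvPolynomial Literature.Computability.AlgebraicComplexity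

/-- The twisted generic determinant `det (X_{ij} · u_{ij})` over a commutative ring `R` is the
image of the generic determinant under the substitution `X_{ij} ↦ X_{ij} · u_{ij}`, hence has
complexity `≤ 8(n+1)⁷ + n²` over `R` (Berkowitz, tree fact `complexity_detPoly_le`, plus one
product gate per entry). [folklore] -/
theorem complexity_det_twist_le (R : Type*) [CommRing R] (n : ℕ) (u : Fin n → Fin n → R) :
    complexity (Matrix.det (Matrix.of fun i j : Fin n =>
      (X (i, j) : MvPolynomial (Fin n × Fin n) R) * C (u i j))) ≤ 8 * (n + 1) ^ 7 + n ^ 2 := by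
  have hdet : Matrix.det (Matrix.of fun i j : Fin n =>
      (X (i, j) : MvPolynomial (Fin n × Fin n) R) * C (u i j)) =
      aeval (fun p : Fin n × Fin n => (X p : MvPolynomial (Fin n × Fin n) R) * C (u p.1 p.2))
        (detPoly (Fin n) R) := by
    rw [detPoly, AlgHom.map_det]
    congr 1
    ext i j
    simp [Matrix.mvPolynomialX]
  rw [hdet]
  refine (complexity_aeval_le _ _).trans ?_
  have h1 := complexity_detPoly_le R n
  have h2 : ∑ p : Fin n × Fin n,
      complexity ((X p : MvPolynomial (Fin n × Fin n) R) * C (u p.1 p.2)) ≤ n ^ 2 := by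
    calc ∑ p : Fin n × Fin n, complexity ((X p : MvPolynomial (Fin n × Fin n) R) * C (u p.1 p.2))
        ≤ ∑ _p : Fin n × Fin n, 1 := Finset.sum_le_sum fun p _ =>
          (complexity_mul_le_holds _ _).trans (by rw [complexity_X_holds p, complexity_C_holds])
      _ = n ^ 2 := by simp; ring
  omega

/-- If `(R, u, ℓ)` realises the sign character, then `ℓ` applied coefficientwise to the twisted
determinant `det (X_{ij} · u_{ij})` over `R[X]` is the permanent `per_n` over `ℂ`
(`linearMap_coeff_det_twist` with `sgn² = 1`; Marcus–Minc 1961 for `R = ℂ`). [folklore] -/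
theorem lmap_det_twist_eq_perPoly (n : ℕ) (R : Type*) [CommRing R] [Algebra ℂ R]
    (u : Fin n → Fin n → R) (ℓ : R →ₗ[ℂ] ℂ)
    (hu : ∀ σ : Equiv.Perm (Fin n), ℓ (∏ i, u (σ i) i) = ((Equiv.Perm.sign σ : ℤ) : ℂ)) :
    CommExtSim.lmap ℓ (Matrix.det (Matrix.of fun i j : Fin n =>
      (X (i, j) : MvPolynomial (Fin n × Fin n) R) * C (u i j))) = perPoly (Fin n) ℂ := by
  ext m
  rw [CommExtSim.coeff_lmap,
    linearMap_coeff_det_twist (fun σ : Equiv.Perm (Fin n) => ((Equiv.Perm.sign σ : ℤ) : ℂ)) u ℓ hu m]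
  congr 1
  have hsq : ∀ σ : Equiv.Perm (Fin n),
      ((Equiv.Perm.sign σ : ℤ) : ℂ) * ((Equiv.Perm.sign σ : ℤ) : ℂ) = 1 := by
    intro σ
    rw [← Int.cast_mul, ← Units.val_mul, Int.units_mul_self, Units.val_one, Int.cast_one]
  simp_rw [hsq]
  simp [perPoly, Matrix.permanent, Matrix.mvPolynomialX]

/-- Elementary arithmetic for the final bound: with `m = n + s + 2`, `d ≤ s` and
`L ≤ 8(n+1)⁷ + n²`, one has `(5d³ + 6d² + 2d) L + 3d ≤ m¹⁷`. [folklore] -/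
theorem simulationCost_arith (n s d L : ℕ) (hd : d ≤ s) (hL : L ≤ 8 * (n + 1) ^ 7 + n ^ 2) :
    (5 * d ^ 3 + 6 * d ^ 2 + 2 * d) * L + 3 * d ≤ (n + s + 2) ^ 17 := by
  set m := n + s + 2 with hm
  have hm2 : 2 ≤ m := by omega
  have hdm : d ≤ m := by omega
  have hnm : n + 1 ≤ m := by omega
  have hd3 : d ^ 3 ≤ m ^ 3 := Nat.pow_le_pow_left hdm 3
  have hd2 : d ^ 2 ≤ m ^ 3 :=
    (Nat.pow_le_pow_left hdm 2).trans (Nat.pow_le_pow_right (by omega) (by norm_num))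
  have hd1 : d ≤ m ^ 3 := hdm.trans (Nat.le_self_pow (by norm_num) m)
  have hA : 5 * d ^ 3 + 6 * d ^ 2 + 2 * d ≤ 13 * m ^ 3 := by omega
  have hn7 : (n + 1) ^ 7 ≤ m ^ 7 := Nat.pow_le_pow_left hnm 7
  have hn2 : n ^ 2 ≤ m ^ 7 :=
    (Nat.pow_le_pow_left (by omega : n ≤ m) 2).trans (Nat.pow_le_pow_right (by omega) (by norm_num))
  have hB : L ≤ 9 * m ^ 7 := by omega
  have hAB : (5 * d ^ 3 + 6 * d ^ 2 + 2 * d) * L ≤ 117 * m ^ 10 := by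
    calc (5 * d ^ 3 + 6 * d ^ 2 + 2 * d) * L ≤ (13 * m ^ 3) * (9 * m ^ 7) := Nat.mul_le_mul hA hB
      _ = 117 * m ^ 10 := by ring
  have hC : 3 * d ≤ 3 * m ^ 10 := by
    have : d ≤ m ^ 10 := hdm.trans (Nat.le_self_pow (by norm_num) m)
    omega
  have h27 : 2 ^ 7 ≤ m ^ 7 := Nat.pow_le_pow_left hm2 7
  calc (5 * d ^ 3 + 6 * d ^ 2 + 2 * d) * L + 3 * d ≤ 117 * m ^ 10 + 3 * m ^ 10 := by omega
    _ = 120 * m ^ 10 := by ring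
    _ ≤ 2 ^ 7 * m ^ 10 := by gcongr; norm_num
    _ ≤ m ^ 7 * m ^ 10 := Nat.mul_le_mul_right _ h27
    _ = m ^ 17 := by ring

/-- **SimulationCost** (item stmt-ValiantsHypothesis-7292 of route FermionizationDimension;
Hrubeš–Yehudayoff 2011, Thm 4.2 in the commutative case, composed with Berkowitz's
division-free determinant): a commutative realisation `(R, u, ℓ)` of the sign character of
`S_n` with `dim_ℂ R ≤ s` yields `L(per_n) ≤ (n + s + 2)^17` — run the determinant of
`(X_{ij} u_{ij})` over `R[X]` coordinatewise (`5d³ + 6d² + 2d` scalar gates per ring operation,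
`d = dim R`) and apply `ℓ`. [cite: HrubesYehudayoff2011, Thm 4.2] -/
theorem simulationCost_proof :
    Summit.ValiantsHypothesis.ValiantsHypothesis.Theses.FermionizationDimension.SimulationCost := by
  refine ⟨17, fun n s => ?_⟩
  rintro ⟨R, _, _, _, u, ℓ, hdim, hu⟩
  let b := Module.finBasis ℂ R
  have hL := CommExtSim.complexity_lmap_le b ℓ (Matrix.det (Matrix.of fun i j : Fin n =>
      (X (i, j) : MvPolynomial (Fin n × Fin n) R) * C (u i j)))
  rw [lmap_det_twist_eq_perPoly n R u ℓ hu, Fintype.card_fin] at hL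
  exact hL.trans (simulationCost_arith n s _ _ hdim (complexity_det_twist_le R n u))

end Summit.ValiantsHypothesis.Theorems
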